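import Literature.MathematicalPhysics.StatisticalMechanics.CapacityPartitionFunctionZeroFreeRatios
import Literature.MathematicalPhysics.StatisticalMechanics.UNPartitionFunctionZeros
import Literature.MathematicalPhysics.StatisticalMechanics.NJLChiralCondensateLowerBound
import Literature.MathematicalPhysics.StatisticalMechanics.ComplexSpinCorrelationBoundAllColours
import HarnessLib

/-!
# The chiral condensate of the U(N) model at β = 0: Salmhofer–Seiler's Remark 4.10 (3) / (4.44)
# with its clustering hypothesis discharged by the Hall–Puder–Sawin ∕ Amini zero-free theorem

A further file of the Salmhofer–Seiler series.  Salmhofer–Seiler (CMP 139 (1991)) prove the LOWER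
bound (4.8) on the chiral condensate `s = ⟨σ_x⟩ = (2N)⁻¹⟨ψ̄ψ⟩` at mass `m > 0` — hence
`liminf_{m→0⁺} ⟨ψ̄ψ⟩ > 0`, chiral symmetry breaking in the condensate form — for the NJL systems
(Thm. 4.3, Cor. 4.4; the tree's `NJLChiralCondensateLowerBound`), and state the `U(N)` analogue only
conditionally: «(3) Assuming that clustering holds for `m > 0` also in the `U(N)`-model one can again
get a lower bound for the chiral order parameter» ((4.44), Remark 4.10 (3), p. 423).  The tree's NJL
proof does not use clustering but the weaker «clustering on average» — the volume-uniform
susceptibility bound `|∑_y ⟨σ_0;σ_y⟩_Λ| ≤ 1/(N m²)` (`NJLMassDerivative`), obtained from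
Heilmann–Lieb's zero-free half-plane and ratio bounds by Cauchy's estimate.  For `U(N)` the
zero-free half-plane is the Hall–Puder–Sawin ∕ Amini theorem (the `β = 0` `U(N)` partition function
is the `N`-matching polynomial), vendored as the named fact `HallPuderSawinAmini_uNZeroFree`
(`UNPartitionFunctionZeros`), and the ratio bounds follow from zero-freeness alone
(`CapacityPartitionFunctionZeroFreeRatios`).  This file runs the NJL argument for the `U(N)` bond
data `a_k = (N-k)! N^{2k}/(N! k!)` ((4.27), `uNBondCoeff`) with the fact as a DISPLAYED HYPOTHESIS
`(h : HallPuderSawinAmini_uNZeroFree)`, and Salmhofer–Seiler's `K(N)` replaced by the sharp constant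
`N` of the tree's `ComplexSpinSchwingerDysonSharp` (so no restriction `N ≤ 4`):

* `uNCapZ N c m` — the `U(N)` capacity partition functions on the torus at complex mass, with
  `uN_partitionFunction_ofReal`, `uN_bracket_X_ofReal`, `uN_twoPt_ofReal`, `uN_expect_X_ofReal`
  (at real mass they are the tree's `partitionFunction ∕ bracket ∕ twoPt ∕ expect N m (uNBondCoeff N)`);
* **`uNCapZ_ne_zero_of_re_pos (h)`** — Salmhofer–Seiler's Theorem 3.6 for the `U(N)` model: no zeros
  with `Re m > 0`, every capacity `c ≤ N`, every `N ≥ 1`, every even torus; `norm_uNCapRatio_top_le (h)`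
  — `|⟨σ_z⟩_Λ(m)| ≤ (2 Re m)⁻¹` uniformly in the volume (the Erratum's bound, for `U(N)`);
* `MonomerDimer.Z_eq_sum_antidiagonal`, **`MonomerDimer.hasDerivAt_Z_expData`**,
  `hasDerivAt_uNCapZ` — `d/dm Z_Λ(c)(m) = 2N ∑_y Zd_Λ(c, y)(m)` for ARBITRARY bond data (proved
  from the monomer expansion, not from the Heilmann–Lieb recursion, which exists only for
  exponential bond data), and the fluctuation formula `hasDerivAt_uNCapRatio_top`;
* **`uN_susceptibility_bound (h)`** — `|∑_y (⟨σ_zσ_y⟩_Λ - ⟨σ_z⟩_Λ⟨σ_y⟩_Λ)| ≤ 1/(N m²)` at real `m > 0`,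
  uniformly in `Λ`; `uN_twoPtHat_zero_le (h)` — the `k = 0` mode;
* **`uN_sd_ineq_finiteVolume (h)`** — (4.15) for `U(N)` with the sharp constant:
  `1 - 2m s_Λ ≤ 2νN s_Λ² + 2 S_Λ(ν) + 5ν/(2m²|Λ|)` on every even torus;
* **`uN_condensate_lower_bound (h)`** — Remark 4.10 (3) ∕ (4.44) with its hypothesis discharged
  by `h`: for `ν ≥ 3`, `N ≥ 1`, `m > 0` and every `ε > 0` there is `L₀` with
  `⟨σ_0⟩_Λ(m) ≥ s₂(m) - ε`, `s₂(m) = (√(m² + 2νN(1 - 2S(ν))) - m)/(2νN)`, for all even `L ≥ L₀`;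
  and **`uN_chiralCondensate_pos (h)`**: if `2S(ν) < 1` (certified for `ν ≥ 4` elsewhere in the
  tree), then for every `0 < m ≤ 1`, every `ε > 0` and all large even `L`,
  `⟨σ_0⟩_Λ(m) ≥ (1 - 2S(ν))/(√(1 + 2νN(1 - 2S(ν))) + 1) - ε`, a positive constant
  (`uN_chiralCondensate_const_pos`) independent of `m` and `L` — the condensate form of chiral
  symmetry breaking for the `U(N)` model at `β = 0`, every `N`.

Honest framing.  `β = 0` `U(N)` lattice gauge theory with one staggered fermion in Salmhofer–Seiler's
complex-spin form, on even tori, real mass; every statement marked `(h)` is CONDITIONAL on the vendored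
fact (Q1 vend #1 of the cell pub-ymgap; its proof — Grace–Walsh–Szegő ∕ interlacing — is not in
Mathlib).  The thermodynamic limit of the condensate is not asserted (bounds are uniform in the
volume instead).  Nothing about `SU(N)` (whose partition function is NOT zero-free: baryon loops),
`β > 0`, the continuum, or the summit's `QCD` conjunct.

## References

* M. Salmhofer, E. Seiler, *Proof of chiral symmetry breaking in strongly coupled lattice gauge
  theory*, Commun. Math. Phys. 139 (1991) 395–432: Thm. 3.6, Thm. 4.3 with (4.8)–(4.15), Cor. 4.4,
  (4.27), Lemma 4.7, Remark 4.10 (3) and (4.44). [SalmhoferSeiler1991]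
* M. Salmhofer, E. Seiler, Erratum, Commun. Math. Phys. 146 (1992) 637–638, (5). [SalmhoferSeiler1992Erratum]
* C. Hall, D. Puder, W. F. Sawin, Adv. Math. 323 (2018) 367–410, §2.2, §5.2. [HallPuderSawin2018]
* N. Amini, arXiv:1905.02264, Thm. 3.7. [Amini2019]
-/

noncomputable section

open MvPolynomial Finset Filter Topology Metric Set

namespace Literature.MathematicalPhysics.StatisticalMechanics

namespace MonomerDimer

/-! ### The mass derivative of a capacity partition function with arbitrary bond data -/

section MassDerivative

variable {V β : Type*} [Fintype V] [Fintype β] [DecidableEq V]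

omit [DecidableEq V] in
/-- The coefficient of `σ^d` in `∏_x F_x^{≤D}(σ_x)` is `∏_x f_x(d_x)` (`d ≤ D`), else `0`.
[cite: SalmhoferSeiler1991, (3.1) and Remark 3.2] -/
theorem coeff_prod_siteFactor {R : Type*} [CommRing R] (D : ℕ) (f : V → ℕ → R) (d : V →₀ ℕ) :
    coeff d (∏ x, siteFactor D f x) = if ∀ x, d x ≤ D then ∏ x, f x (d x) else 0 := by
  classical
  unfold siteFactor
  rw [Finset.prod_univ_sum, coeff_sum]
  have hterm : ∀ φ : V → ℕ,
      (∏ x, C (f x (φ x)) * X x ^ (φ x) : MvPolynomial V R) =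
        monomial (Finsupp.equivFunOnFinite.symm φ) (∏ x, f x (φ x)) := by
    intro φ
    rw [prod_mul_distrib, ← map_prod C, monomial_eq, Finsupp.prod_fintype _ _ (fun _ => pow_zero _)]
    rfl
  simp_rw [hterm, coeff_monomial]
  split_ifs with hd
  · rw [Finset.sum_eq_single (⇑d : V → ℕ)]
    · rw [if_pos (Finsupp.equivFunOnFinite_symm_coe d)]
    · intro φ _ hφ
      rw [if_neg]
      intro h
      apply hφ
      rw [← h]
      rfl
    · intro h
      exact absurd (Fintype.mem_piFinset.2 fun x => Finset.mem_range.2 (Nat.lt_succ_of_le (hd x))) h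
  · refine Finset.sum_eq_zero fun φ hφ => ?_
    rw [if_neg]
    intro h
    apply hd
    intro x
    have hx := Fintype.mem_piFinset.1 hφ x
    rw [Finset.mem_range, Nat.lt_succ_iff] at hx
    rw [← h]
    exact hx

/-- **The monomer expansion of `Z(c)`**: splitting the exponent `c = d + e` between the site factors
(`d`, weight `∏_x f_x(d_x)`) and the bond factors (`e`). [cite: SalmhoferSeiler1991, (3.1) and (3.7)] -/
theorem Z_eq_sum_antidiagonal {R : Type*} [CommRing R] (D : ℕ) (s t : β → V) (f : V → ℕ → R)
    (g : β → ℕ → R) {c : V →₀ ℕ} (hc : ∀ x, c x ≤ D) :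
    Z D s t f g c =
      ∑ p ∈ HasAntidiagonal.antidiagonal c, (∏ x, f x (p.1 x)) * coeff p.2 (∏ b, bondFactor D s t g b) := by
  unfold Z boltzmann
  rw [coeff_mul]
  refine Finset.sum_congr rfl fun p hp => ?_
  rw [coeff_prod_siteFactor, if_pos]
  intro x
  have h := Finsupp.ext_iff.1 (HasAntidiagonal.mem_antidiagonal.1 hp) x
  rw [Finsupp.add_apply] at h
  have := hc x
  omega

omit [Fintype β] [DecidableEq V] in
/-- `∏_x a^{d_x}/d_x! = a^{|d|} ∏_x (d_x!)⁻¹`. [folklore] -/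
private theorem prod_expData (a : ℂ) (d : V →₀ ℕ) :
    (∏ x, expData a (d x)) = a ^ (∑ x, d x) * ∏ x, ((Nat.factorial (d x) : ℂ))⁻¹ := by
  simp only [expData, div_eq_mul_inv]
  rw [prod_mul_distrib, Finset.prod_pow_eq_pow_sum]

omit [Fintype β] in
/-- `∑_x δ_y(x) = 1`. [folklore] -/
private theorem sum_single_one_apply (y : V) :
    ∑ x, (Finsupp.single y 1 : V →₀ ℕ) x = 1 := by
  rw [Finset.sum_eq_single y]
  · exact Finsupp.single_eq_same
  · intro x _ hx
    rw [Finsupp.single_apply, if_neg (Ne.symm hx)]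
  · intro h; exact absurd (Finset.mem_univ y) h

omit [Fintype β] in
/-- `(d_y + 1) ∏_x ((d + δ_y)_x!)⁻¹ = ∏_x (d_x!)⁻¹`. [folklore] -/
private theorem succ_mul_prod_inv_factorial_add_single (d : V →₀ ℕ) (y : V) :
    ((d y : ℂ) + 1) * ∏ x, ((Nat.factorial ((d + Finsupp.single y 1 : V →₀ ℕ) x) : ℂ))⁻¹ =
      ∏ x, ((Nat.factorial (d x) : ℂ))⁻¹ := by
  rw [← Finset.mul_prod_erase univ _ (Finset.mem_univ y),
    ← Finset.mul_prod_erase univ (fun x => ((Nat.factorial (d x) : ℂ))⁻¹) (Finset.mem_univ y)]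
  have hprod : ∏ x ∈ univ.erase y, ((Nat.factorial ((d + Finsupp.single y 1 : V →₀ ℕ) x) : ℂ))⁻¹ =
      ∏ x ∈ univ.erase y, ((Nat.factorial (d x) : ℂ))⁻¹ := by
    refine prod_congr rfl fun x hx => ?_
    rw [Finsupp.add_apply, Finsupp.single_apply, if_neg (Finset.ne_of_mem_erase hx).symm, add_zero]
  rw [hprod, ← mul_assoc]
  congr 1
  rw [Finsupp.add_apply, Finsupp.single_eq_same, Nat.factorial_succ]
  push_cast
  have h1 : ((d y : ℂ) + 1) ≠ 0 := Nat.cast_add_one_ne_zero _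
  rw [mul_inv, ← mul_assoc, mul_inv_cancel₀ h1, one_mul]

/-- The combinatorial heart of `d/dm Z = κ ∑_y Zd`: differentiating the monomer weight
`(κm)^{|d|} ∏ (d_x!)⁻¹` produces, for each site `y` carrying a monomer, the weight of `d - δ_y`.
[folklore] -/
private theorem sum_antidiagonal_deriv_weights (κ m : ℂ) (K : (V →₀ ℕ) → ℂ)
    (c : V →₀ ℕ) :
    ∑ p ∈ HasAntidiagonal.antidiagonal c,
        ((∑ x, p.1 x : ℕ) : ℂ) * (κ * m) ^ ((∑ x, p.1 x) - 1) * (κ * 1) *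
          ((∏ x, ((Nat.factorial (p.1 x) : ℂ))⁻¹) * K p.2) =
      κ * ∑ y ∈ c.support, ∑ q ∈ HasAntidiagonal.antidiagonal (c - Finsupp.single y 1 : V →₀ ℕ),
        (κ * m) ^ (∑ x, q.1 x) * ((∏ x, ((Nat.factorial (q.1 x) : ℂ))⁻¹) * K q.2) := by
  -- abbreviations
  set T : (V →₀ ℕ) × (V →₀ ℕ) → ℂ := fun p =>
    (κ * m) ^ ((∑ x, p.1 x) - 1) * (κ * 1) * ((∏ x, ((Nat.factorial (p.1 x) : ℂ))⁻¹) * K p.2) with hT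
  set U : (V →₀ ℕ) × (V →₀ ℕ) → ℂ := fun q =>
    (κ * m) ^ (∑ x, q.1 x) * ((∏ x, ((Nat.factorial (q.1 x) : ℂ))⁻¹) * K q.2) with hU
  -- expand `|d| = ∑_y d_y` and swap the sums
  have h1 : ∀ p ∈ HasAntidiagonal.antidiagonal c,
      ((∑ x, p.1 x : ℕ) : ℂ) * (κ * m) ^ ((∑ x, p.1 x) - 1) * (κ * 1) *
          ((∏ x, ((Nat.factorial (p.1 x) : ℂ))⁻¹) * K p.2) =
        ∑ y, (p.1 y : ℂ) * T p := by
    intro p _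
    rw [← Finset.sum_mul, hT]
    push_cast
    ring
  rw [Finset.sum_congr rfl h1, Finset.sum_comm]
  -- pointwise in `y`
  have hmem : ∀ (p : (V →₀ ℕ) × (V →₀ ℕ)), p ∈ HasAntidiagonal.antidiagonal c → ∀ x, p.1 x + p.2 x = c x := by
    intro p hp x
    have h := Finsupp.ext_iff.1 (HasAntidiagonal.mem_antidiagonal.1 hp) x
    rwa [Finsupp.add_apply] at h
  have h2 : ∀ y, ∑ p ∈ HasAntidiagonal.antidiagonal c, (p.1 y : ℂ) * T p =
      if y ∈ c.support then
        κ * ∑ q ∈ HasAntidiagonal.antidiagonal (c - Finsupp.single y 1 : V →₀ ℕ), U q else 0 := by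
    intro y
    split_ifs with hy
    · have hcy : 1 ≤ c y := Nat.one_le_iff_ne_zero.2 (Finsupp.mem_support_iff.1 hy)
      -- only `p` with a monomer at `y` contribute
      rw [← Finset.sum_filter_of_ne (p := fun p => y ∈ p.1.support) (fun p _ hne =>
        Finsupp.mem_support_iff.2 fun h0 => hne (by rw [h0, Nat.cast_zero, zero_mul]))]
      rw [Finset.mul_sum]
      symm
      refine Finset.sum_nbij' (fun q => (q.1 + Finsupp.single y 1, q.2))
        (fun p => (p.1 - Finsupp.single y 1, p.2)) ?_ ?_ ?_ ?_ ?_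
      · -- into the filtered antidiagonal
        intro q hq
        have hqx := hmem' q hq
        simp only [Finset.mem_filter, HasAntidiagonal.mem_antidiagonal, Finsupp.mem_support_iff]
        refine ⟨?_, ?_⟩
        · ext x
          rw [Finsupp.add_apply, Finsupp.add_apply, Finsupp.single_apply]
          have h := hqx x
          rw [Finsupp.tsub_apply, Finsupp.single_apply] at h
          by_cases hxy : y = x
          · subst hxy; rw [if_pos rfl] at h ⊢; omega
          · rw [if_neg hxy] at h ⊢; omega
        · rw [Finsupp.add_apply, Finsupp.single_eq_same]; omega
      · -- back
        intro p hp
        simp only [Finset.mem_filter, Finsupp.mem_support_iff] at hp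
        have hpx := hmem p hp.1
        simp only [HasAntidiagonal.mem_antidiagonal]
        ext x
        rw [Finsupp.add_apply, Finsupp.tsub_apply, Finsupp.tsub_apply, Finsupp.single_apply]
        have h := hpx x
        by_cases hxy : y = x
        · subst hxy; rw [if_pos rfl]; have := hp.2; omega
        · rw [if_neg hxy]; omega
      · intro q _
        dsimp only
        ext x
        · simp only [Finsupp.tsub_apply, Finsupp.add_apply]; omega
        · rfl
      · intro p hp
        rw [Finset.mem_filter, Finsupp.mem_support_iff] at hp
        dsimp only
        ext x
        · simp only [Finsupp.tsub_apply, Finsupp.add_apply, Finsupp.single_apply]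
          by_cases hxy : y = x
          · subst hxy; rw [if_pos rfl]; have := hp.2; omega
          · rw [if_neg hxy]; omega
        · rfl
      · -- the weights match
        intro q _
        dsimp only
        have hn : (∑ x, (q.1 + Finsupp.single y 1 : V →₀ ℕ) x) - 1 = ∑ x, q.1 x := by
          simp only [Finsupp.add_apply]
          rw [Finset.sum_add_distrib, sum_single_one_apply]
          omega
        have hA := succ_mul_prod_inv_factorial_add_single q.1 y
        simp only [hT, hU]
        rw [hn, Finsupp.add_apply, Finsupp.single_eq_same, ← hA]
        push_cast
        ring
    · -- no monomer can sit at `y`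
      refine Finset.sum_eq_zero fun p hp => ?_
      have h := hmem p hp y
      have hc0 : c y = 0 := by simpa [Finsupp.mem_support_iff] using hy
      have hp0 : p.1 y = 0 := by omega
      rw [hp0, Nat.cast_zero, zero_mul]
  rw [Finset.sum_congr rfl fun y _ => h2 y, Finset.sum_ite_mem, Finset.univ_inter, Finset.mul_sum]
  where
  /-- membership in a shifted antidiagonal, pointwise -/
  hmem' : ∀ {c : V →₀ ℕ} {y : V} (q : (V →₀ ℕ) × (V →₀ ℕ)),
      q ∈ HasAntidiagonal.antidiagonal (c - Finsupp.single y 1 : V →₀ ℕ) →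
        ∀ x, q.1 x + q.2 x = (c - Finsupp.single y 1 : V →₀ ℕ) x :=
    fun q hq x => by
      have h := Finsupp.ext_iff.1 (HasAntidiagonal.mem_antidiagonal.1 hq) x
      rwa [Finsupp.add_apply] at h

/-- **`d/dm Z(c)(m) = κ ∑_y Zd(c, y)(m)`** for the uniform exponential site data `f_x(j) = (κm)^j/j!`
(site weight `e^{κ m σ_x}`) and ARBITRARY bond data: the partition functions are polynomials in the
mass whose derivative removes one unit of capacity at one site (Heilmann–Lieb's "linear in each
vertex activity", here from the monomer expansion rather than from a recursion, so that it applies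
to the `U(N)` bond data as well). [cite: HeilmannLieb1972, (2.9)–(2.12)][cite: SalmhoferSeiler1991, (3.1), Def. 3.3 and (4.10)] -/
theorem hasDerivAt_Z_expData {D : ℕ} {s t : β → V} {g : β → ℕ → ℂ} {c : V →₀ ℕ} (κ : ℂ)
    (hc : ∀ x, c x ≤ D) (m : ℂ) :
    HasDerivAt (fun m : ℂ => Z D s t (fun _ => expData (κ * m)) g c)
      (κ * ∑ y, Zdrop D s t (fun _ => expData (κ * m)) g c y) m := by
  classical
  set K : (V →₀ ℕ) → ℂ := fun e => coeff e (∏ b, bondFactor D s t g b) with hK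
  -- the monomer expansion, for every capacity `c' ≤ D`
  have hZ : ∀ (c' : V →₀ ℕ), (∀ x, c' x ≤ D) → ∀ m' : ℂ,
      Z D s t (fun _ => expData (κ * m')) g c' =
        ∑ p ∈ HasAntidiagonal.antidiagonal c', (κ * m') ^ (∑ x, p.1 x) *
          ((∏ x, ((Nat.factorial (p.1 x) : ℂ))⁻¹) * K p.2) := by
    intro c' hc' m'
    rw [Z_eq_sum_antidiagonal D s t _ g hc']
    refine Finset.sum_congr rfl fun p _ => ?_
    rw [prod_expData, mul_assoc]
  -- differentiate the finite sum of monomials in `m`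
  have hderiv : HasDerivAt (fun m' : ℂ => ∑ p ∈ HasAntidiagonal.antidiagonal c, (κ * m') ^ (∑ x, p.1 x) *
        ((∏ x, ((Nat.factorial (p.1 x) : ℂ))⁻¹) * K p.2))
      (∑ p ∈ HasAntidiagonal.antidiagonal c, ((∑ x, p.1 x : ℕ) : ℂ) * (κ * m) ^ ((∑ x, p.1 x) - 1) * (κ * 1) *
        ((∏ x, ((Nat.factorial (p.1 x) : ℂ))⁻¹) * K p.2)) m :=
    HasDerivAt.fun_sum fun p _ => (((hasDerivAt_id' m).const_mul κ).pow _).mul_const _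
  have hfun : (fun m' : ℂ => Z D s t (fun _ => expData (κ * m')) g c) =
      fun m' : ℂ => ∑ p ∈ HasAntidiagonal.antidiagonal c, (κ * m') ^ (∑ x, p.1 x) *
        ((∏ x, ((Nat.factorial (p.1 x) : ℂ))⁻¹) * K p.2) := funext fun m' => hZ c hc m'
  rw [hfun]
  refine hderiv.congr_deriv ?_
  rw [sum_antidiagonal_deriv_weights κ m K c]
  congr 1
  -- `∑_{y ∈ supp c} Z(c - δ_y) = ∑_y Zd(c, y)`
  rw [← Finset.univ_inter c.support, ← Finset.sum_ite_mem]
  refine Finset.sum_congr rfl fun y _ => ?_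
  unfold Zdrop
  split_ifs with hy
  · exact (hZ _ (fun x => by rw [Finsupp.tsub_apply]; exact (Nat.sub_le _ _).trans (hc x)) m).symm
  · rfl

end MassDerivative

end MonomerDimer

namespace ComplexSpin

open MonomerDimer

open Literature.Probability.LatticeModels (TorusSite Site)
open Literature.Probability.LatticeModels

variable {ν L : ℕ}

/-! ### The U(N) capacity partition functions at complex mass -/

section Defs

variable [NeZero L]

/-- The `U(N)` bond data `a_k = (N-k)! N^{2k}/(N! k!)` read in `ℂ` (the one-link integral (4.27)).
[cite: SalmhoferSeiler1991, (4.27)] -/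
def uNBondDataC (N : ℕ) : TorusSite ν L × Fin ν → ℕ → ℂ :=
  fun _ j => ((uNBondCoeff N j : ℝ) : ℂ)

/-- `Z_Λ(c)(m)`: the capacity partition function of the `β = 0` `U(N)` model on the torus at complex
mass `m` (site weight `e^{2Nmσ}`, bond weight `∑_k a_k (σσ')^k`); `[σ^l]_Λ(m) = Z_Λ(N - l)(m)`.
[cite: SalmhoferSeiler1991, (3.1), Remark 3.2 and (4.27)] -/
def uNCapZ (N : ℕ) (c : TorusSite ν L →₀ ℕ) (m : ℂ) : ℂ :=
  MonomerDimer.Z N linkSrc linkTgt (njlSiteData N m) (uNBondDataC (ν := ν) (L := L) N) c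

/-- `Z_Λ(c - δ_y)(m)` if `c` has capacity at `y`, else `0`. [cite: SalmhoferSeiler1991, (3.46)] -/
def uNCapZdrop (N : ℕ) (c : TorusSite ν L →₀ ℕ) (y : TorusSite ν L) (m : ℂ) : ℂ :=
  if y ∈ c.support then uNCapZ N (c - Finsupp.single y 1) m else 0

/-- The one-step ratio `Z_Λ(c - δ_z)(m)/Z_Λ(c)(m)`; for `c ≡ N` it is `⟨σ_z⟩_Λ(m)`.
[cite: SalmhoferSeiler1991, (3.2) and (3.46)] -/
def uNCapRatio (N : ℕ) (z : TorusSite ν L) (c : TorusSite ν L →₀ ℕ) (m : ℂ) : ℂ :=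
  uNCapZ N (c - Finsupp.single z 1) m / uNCapZ N c m

end Defs

/-! ### Consistency with the tree's real-mass U(N) complex spin system -/

section Real

variable [NeZero L]

/-- At real mass the Boltzmann polynomial of `uNCapZ` is the tree's `boltzmannC` with `U(N)` data.
[cite: SalmhoferSeiler1991, Def. 3.1 and (4.27)] -/
theorem uN_boltzmann_ofReal (N : ℕ) (m : ℝ) :
    MonomerDimer.boltzmann N linkSrc linkTgt (njlSiteData N (m : ℂ))
        (uNBondDataC (ν := ν) (L := L) N) =
      boltzmannC N (fun j => (2 * N * m) ^ j / (Nat.factorial j : ℝ)) (uNBondCoeff N) := by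
  have hs : ∀ x : TorusSite ν L, MonomerDimer.siteFactor N (njlSiteData N (m : ℂ)) x =
      siteWeightC N (fun j => (2 * N * m) ^ j / (Nat.factorial j : ℝ)) x := by
    intro x
    unfold MonomerDimer.siteFactor siteWeightC njlSiteData
    refine Finset.sum_congr rfl fun j _ => ?_
    simp only [Complex.ofReal_div, Complex.ofReal_pow, Complex.ofReal_mul, Complex.ofReal_natCast,
      Complex.ofReal_ofNat]
  have hb : ∀ b : TorusSite ν L × Fin ν,
      MonomerDimer.bondFactor N linkSrc linkTgt (uNBondDataC (ν := ν) (L := L) N) b =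
        bondWeightC N (uNBondCoeff N) b.1 (b.1 + Pi.single b.2 1) := fun b => rfl
  unfold MonomerDimer.boltzmann boltzmannC
  rw [Fintype.prod_prod_type]
  simp_rw [hs, hb]

/-- At real mass the tree's bracket of a monomial is a `U(N)` capacity partition function:
`[σ^l]_Λ(m) = Z_Λ(N - l)(m)` (and `0` if some `l_x > N`). [cite: SalmhoferSeiler1991, Remark 3.2] -/
theorem uN_bracket_monomial_ofReal (N : ℕ) (m : ℝ) (l : TorusSite ν L →₀ ℕ) :
    ((bracket N m (uNBondCoeff N) (monomial l (1 : ℝ)) : ℝ) : ℂ) =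
      if l ≤ topExponent N then uNCapZ N (topExponent (ν := ν) (L := L) N - l) (m : ℂ) else 0 := by
  rw [bracket_eq_bracketC, bracketC, ← uN_boltzmann_ofReal, map_monomial, map_one]
  unfold uNCapZ MonomerDimer.Z
  rw [coeff_monomial_mul']
  split_ifs <;> simp

/-- `Z_Λ(m) = Z_Λ(N,…,N)(m)`. [cite: SalmhoferSeiler1991, (3.1)] -/
theorem uN_partitionFunction_ofReal (N : ℕ) (m : ℝ) :
    ((partitionFunction (ν := ν) (L := L) N m (uNBondCoeff N) : ℝ) : ℂ) =
      uNCapZ N (topExponent (ν := ν) (L := L) N) (m : ℂ) := by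
  have h := uN_bracket_monomial_ofReal (ν := ν) (L := L) N m 0
  have h0 : (0 : TorusSite ν L →₀ ℕ) ≤ topExponent (ν := ν) (L := L) N := fun _ => Nat.zero_le _
  rw [if_pos h0, tsub_zero] at h
  rw [partitionFunction, ← h]
  rfl

/-- `[σ_y]_Λ(m) = Z_Λ(N - δ_y)(m)`. [cite: SalmhoferSeiler1991, Remark 3.2] -/
theorem uN_bracket_X_ofReal {N : ℕ} (hN : 1 ≤ N) (m : ℝ) (y : TorusSite ν L) :
    ((bracket N m (uNBondCoeff N) (X y) : ℝ) : ℂ) =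
      uNCapZ N (topExponent N - Finsupp.single y 1) (m : ℂ) := by
  have hXy : (X y : MvPolynomial (TorusSite ν L) ℝ) = monomial (Finsupp.single y 1) 1 := rfl
  have hle : Finsupp.single y 1 ≤ topExponent (ν := ν) (L := L) N :=
    Finsupp.single_le_iff.2 (by rw [topExponent_apply']; exact hN)
  rw [hXy, uN_bracket_monomial_ofReal, if_pos hle]

/-- `[σ_0σ_z]_Λ(m) = Zd_Λ(N - δ_0, z)(m)`. [cite: SalmhoferSeiler1991, Remark 3.2] -/
theorem uN_twoPt_ofReal {N : ℕ} (hN : 1 ≤ N) (m : ℝ) (z : TorusSite ν L) :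
    ((twoPt N m (uNBondCoeff N) (0 : TorusSite ν L) z : ℝ) : ℂ) =
      uNCapZdrop N (topExponent N - Finsupp.single (0 : TorusSite ν L) 1) z (m : ℂ) := by
  classical
  have hX : (X (0 : TorusSite ν L) * X z : MvPolynomial (TorusSite ν L) ℝ) =
      monomial (Finsupp.single 0 1 + Finsupp.single z 1) 1 := by
    rw [X, X, monomial_mul, mul_one]
  have h0 : Finsupp.single (0 : TorusSite ν L) 1 ≤ topExponent (ν := ν) (L := L) N :=
    Finsupp.single_le_iff.2 (by rw [topExponent_apply']; exact hN)
  have hiff : Finsupp.single (0 : TorusSite ν L) 1 + Finsupp.single z 1 ≤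
        topExponent (ν := ν) (L := L) N ↔
      z ∈ (topExponent (ν := ν) (L := L) N - Finsupp.single 0 1).support := by
    rw [← le_tsub_iff_left h0, Finsupp.single_le_iff, Finsupp.mem_support_iff,
      Nat.one_le_iff_ne_zero]
  rw [twoPt, hX, uN_bracket_monomial_ofReal]
  unfold uNCapZdrop
  by_cases h : z ∈ (topExponent (ν := ν) (L := L) N - Finsupp.single 0 1).support
  · rw [if_pos (hiff.2 h), if_pos h, tsub_tsub]
  · rw [if_neg (mt hiff.1 h), if_neg h]

/-- `⟨σ_y⟩_Λ(m) = Z_Λ(N - δ_y)(m)/Z_Λ(N)(m)`. [cite: SalmhoferSeiler1991, (3.2)] -/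
theorem uN_expect_X_ofReal {N : ℕ} (hN : 1 ≤ N) (m : ℝ) (y : TorusSite ν L) :
    ((expect N m (uNBondCoeff N) (X y) : ℝ) : ℂ) =
      uNCapRatio N y (topExponent (ν := ν) (L := L) N) (m : ℂ) := by
  rw [expect_eq_div, Complex.ofReal_div, uN_bracket_X_ofReal hN, uN_partitionFunction_ofReal]
  rfl

end Real

/-! ### Theorem 3.6 for the U(N) model (given the vendored fact) and the ratio bounds -/

section ZeroFree

variable [NeZero L]

omit [NeZero L] in
/-- On a torus of side `L ≥ 2` no link is a loop: `x + e_μ ≠ x`. [folklore] -/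
private theorem linkTgt_ne_linkSrc (hL2 : 2 ≤ L) (b : TorusSite ν L × Fin ν) :
    linkSrc b ≠ linkTgt b := by
  haveI : NeZero L := ⟨by omega⟩
  intro h
  have h' := congr_fun h b.2
  simp only [linkSrc, linkTgt, Pi.add_apply, Pi.single_eq_same] at h'
  have h1 : (1 : ZMod L) = 0 := by
    have := h'.symm
    rwa [add_eq_left] at this
  haveI : Fact (1 < L) := ⟨by omega⟩
  exact one_ne_zero h1

omit [NeZero L] in
/-- The `U(N)` site data with the activity at `z` replaced by `w` are of the form required by the
fact (`a_v^j/j!` with `Re a_v > 0`). [folklore] -/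
private theorem update_njlSiteData_eq (N : ℕ) (m w : ℂ) (z : TorusSite ν L) :
    Function.update (njlSiteData (ν := ν) (L := L) N m) z (expData w) =
      fun v j => (if v = z then w else 2 * N * m) ^ j / (Nat.factorial j : ℂ) := by
  funext v j
  by_cases hv : v = z
  · subst hv; simp [Function.update_self, expData]
  · rw [Function.update_of_ne hv, if_neg hv]; rfl

/-- **Theorem 3.6 for the `U(N)` model, all capacities** (given the Hall–Puder–Sawin ∕ Amini fact): on
an even torus of side `L ≥ 2`, for `N ≥ 1`, `c ≤ N`, and every complex mass with `Re m > 0`, the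
capacity partition function with the activity at one site `z` replaced by any `w`, `Re w > 0`, does
not vanish; in particular `Z_Λ(c)(m) ≠ 0`. [cite: SalmhoferSeiler1991, Thm. 3.6][cite: Amini2019, Thm. 3.7][cite: HallPuderSawin2018, §2.2 and §5.2] -/
theorem uNCapZ_update_ne_zero (h : HallPuderSawinAmini_uNZeroFree) (hL2 : 2 ≤ L) {N : ℕ}
    (hN : 1 ≤ N) {c : TorusSite ν L →₀ ℕ} (hc : ∀ x, c x ≤ N) {m : ℂ} (hm : 0 < m.re)
    (z : TorusSite ν L) {w : ℂ} (hw : 0 < w.re) :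
    MonomerDimer.Z N linkSrc linkTgt (Function.update (njlSiteData (ν := ν) (L := L) N m) z (expData w))
      (uNBondDataC (ν := ν) (L := L) N) c ≠ 0 := by
  rw [update_njlSiteData_eq]
  refine h (TorusSite ν L) (TorusSite ν L × Fin ν) linkSrc linkTgt (linkTgt_ne_linkSrc hL2) N hN c hc
    (fun v => if v = z then w else 2 * N * m) (fun v => ?_)
  by_cases hv : v = z
  · rw [if_pos hv]; exact hw
  · rw [if_neg hv]
    have : ((2 : ℂ) * N * m).re = 2 * N * m.re := by simp [Complex.mul_re]
    rw [this]
    have hN' : (0 : ℝ) < N := by exact_mod_cast hN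
    positivity

/-- **Theorem 3.6 for the `U(N)` model**: `Z_Λ(c)(m) ≠ 0` for `Re m > 0` (every `c ≤ N`, `N ≥ 1`,
`L ≥ 2`), given the vendored fact. [cite: SalmhoferSeiler1991, Thm. 3.6][cite: Amini2019, Thm. 3.7] -/
theorem uNCapZ_ne_zero_of_re_pos (h : HallPuderSawinAmini_uNZeroFree) (hL2 : 2 ≤ L) {N : ℕ}
    (hN : 1 ≤ N) {c : TorusSite ν L →₀ ℕ} (hc : ∀ x, c x ≤ N) {m : ℂ} (hm : 0 < m.re) :
    uNCapZ N c m ≠ 0 := by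
  haveI : Nonempty (TorusSite ν L) := ⟨0⟩
  obtain ⟨z⟩ := (inferInstance : Nonempty (TorusSite ν L))
  have hmz : 0 < ((2 : ℂ) * N * m).re := by
    have : ((2 : ℂ) * N * m).re = 2 * N * m.re := by simp [Complex.mul_re]
    rw [this]
    have hN' : (0 : ℝ) < N := by exact_mod_cast hN
    positivity
  have h1 := uNCapZ_update_ne_zero (ν := ν) (L := L) h hL2 hN hc hm z hmz
  have hupd : Function.update (njlSiteData (ν := ν) (L := L) N m) z (expData (2 * N * m)) =
      njlSiteData (ν := ν) (L := L) N m := by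
    rw [← (isExpData_njlSiteData (ν := ν) (L := L) N m z).eq_expData, Function.update_eq_self]
  rwa [hupd] at h1

/-- **The Erratum's bound for `U(N)`**: `‖Z_Λ(c - δ_z)(m)/Z_Λ(c)(m)‖ ≤ c_z/(2N Re m)` for `Re m > 0`,
uniformly in the volume — from zero-freeness alone (`norm_Z_sub_single_div_Z_le_of_zeroFree`).
[cite: SalmhoferSeiler1992Erratum, (5)][cite: HeilmannLieb1972, Lemma 4.7] -/
theorem norm_uNCapRatio_le (h : HallPuderSawinAmini_uNZeroFree) (hL2 : 2 ≤ L) {N : ℕ} (hN : 1 ≤ N)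
    {c : TorusSite ν L →₀ ℕ} (hc : ∀ x, c x ≤ N) {z : TorusSite ν L} (hz : z ∈ c.support) {m : ℂ}
    (hm : 0 < m.re) :
    ‖uNCapRatio N z c m‖ ≤ c z / (2 * N * m.re) := by
  have hmz : 0 < 1 * ((2 : ℂ) * N * m).re := by
    have : ((2 : ℂ) * N * m).re = 2 * N * m.re := by simp [Complex.mul_re]
    rw [this, one_mul]
    have hN' : (0 : ℝ) < N := by exact_mod_cast hN
    positivity
  have hb := norm_Z_sub_single_div_Z_le_of_zeroFree (D := N) (s := linkSrc) (t := linkTgt)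
    (f := njlSiteData (ν := ν) (L := L) N m) (g := uNBondDataC (ν := ν) (L := L) N) (c := c) (z := z)
    (isExpData_njlSiteData N m z) hz (hc z) (Or.inl rfl) hmz
    (fun w hw => uNCapZ_update_ne_zero h hL2 hN hc hm z (by simpa using hw))
  have hre : 1 * ((2 : ℂ) * N * m).re = 2 * N * m.re := by simp [Complex.mul_re]
  rw [hre] at hb
  exact hb

/-- **`|⟨σ_z⟩_Λ(m)| ≤ (2 Re m)⁻¹`** for the `U(N)` model, `Re m > 0`, uniformly in the volume.
[cite: SalmhoferSeiler1992Erratum, (5)] -/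
theorem norm_uNCapRatio_top_le (h : HallPuderSawinAmini_uNZeroFree) (hL2 : 2 ≤ L) {N : ℕ}
    (hN : 1 ≤ N) (z : TorusSite ν L) {m : ℂ} (hm : 0 < m.re) :
    ‖uNCapRatio N z (topExponent (ν := ν) (L := L) N) m‖ ≤ (2 * m.re)⁻¹ := by
  have htop : ∀ x, topExponent (ν := ν) (L := L) N x ≤ N := fun x => (topExponent_apply' N x).le
  have hz : z ∈ (topExponent (ν := ν) (L := L) N).support := by
    rw [Finsupp.mem_support_iff, topExponent_apply']; omega
  have hb := norm_uNCapRatio_le h hL2 hN htop hz hm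
  rw [topExponent_apply'] at hb
  have hN' : (0 : ℝ) < N := by exact_mod_cast hN
  calc ‖uNCapRatio N z (topExponent (ν := ν) (L := L) N) m‖ ≤ N / (2 * N * m.re) := hb
    _ = (2 * m.re)⁻¹ := by field_simp

end ZeroFree

/-! ### The mass derivative and the fluctuation formula -/

section Derivative

variable [NeZero L] {N : ℕ}

omit [NeZero L] in
/-- Removing capacity keeps the bound `c ≤ N`. [folklore] -/
private theorem tsub_apply_le'' {c : TorusSite ν L →₀ ℕ} (hc : ∀ x, c x ≤ N)
    (l : TorusSite ν L →₀ ℕ) (x : TorusSite ν L) : (c - l) x ≤ N := by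
  rw [Finsupp.tsub_apply]; exact (Nat.sub_le _ _).trans (hc x)

/-- **`d/dm Z_Λ(c)(m) = 2N ∑_y Zd_Λ(c, y)(m)`** for the `U(N)` model (site weight `e^{2Nmσ}`, any
`c ≤ N`). [cite: SalmhoferSeiler1991, Def. 3.3, (4.10) and (4.27)][cite: HeilmannLieb1972, (2.9)–(2.12)] -/
theorem hasDerivAt_uNCapZ (c : TorusSite ν L →₀ ℕ) (hc : ∀ x, c x ≤ N) (m : ℂ) :
    HasDerivAt (fun m => uNCapZ N c m) (2 * N * ∑ y, uNCapZdrop N c y m) m := by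
  have h := MonomerDimer.hasDerivAt_Z_expData (s := linkSrc) (t := linkTgt)
    (g := uNBondDataC (ν := ν) (L := L) N) (c := c) (2 * N : ℂ) hc m
  have hf : ∀ m' : ℂ, (fun _ : TorusSite ν L => expData (2 * N * m')) =
      njlSiteData (ν := ν) (L := L) N m' :=
    fun m' => funext fun x => ((isExpData_njlSiteData (ν := ν) (L := L) N m' x).eq_expData).symm
  simp only [hf] at h
  exact h

/-- The `U(N)` capacity partition functions are differentiable (polynomial) in the mass.
[cite: SalmhoferSeiler1991, Cor. 3.9] -/
theorem differentiable_uNCapZ (c : TorusSite ν L →₀ ℕ) (hc : ∀ x, c x ≤ N) :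
    Differentiable ℂ (fun m => uNCapZ N c m) :=
  fun m => (hasDerivAt_uNCapZ c hc m).differentiableAt

/-- **Fluctuation formula** for the `U(N)` model: wherever `Z_Λ(N)(m) ≠ 0`,
`d/dm ⟨σ_z⟩_Λ(m) = 2N ∑_y (Zd(N-δ_z, y)/Z - ⟨σ_z⟩⟨σ_y⟩) = 2N ∑_y (⟨σ_zσ_y⟩_Λ - ⟨σ_z⟩_Λ⟨σ_y⟩_Λ)`.
[cite: SalmhoferSeiler1991, (3.46) and (4.10)] -/
theorem hasDerivAt_uNCapRatio_top (hN : 1 ≤ N) (z : TorusSite ν L) {m : ℂ}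
    (hZ : uNCapZ N (topExponent (ν := ν) (L := L) N) m ≠ 0) :
    HasDerivAt (fun m => uNCapRatio N z (topExponent (ν := ν) (L := L) N) m)
      (2 * N * ∑ y, (uNCapZdrop N (topExponent N - Finsupp.single z 1) y m /
          uNCapZ N (topExponent (ν := ν) (L := L) N) m -
        uNCapRatio N z (topExponent (ν := ν) (L := L) N) m *
          uNCapRatio N y (topExponent (ν := ν) (L := L) N) m)) m := by
  classical
  have htop : ∀ x, topExponent (ν := ν) (L := L) N x ≤ N := fun x => (topExponent_apply' N x).le
  have hc' : ∀ x, (topExponent (ν := ν) (L := L) N - Finsupp.single z 1 : TorusSite ν L →₀ ℕ) x ≤ N :=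
    tsub_apply_le'' htop _
  have h1 := hasDerivAt_uNCapZ (topExponent N - Finsupp.single z 1) hc' m
  have h2 := hasDerivAt_uNCapZ (topExponent (ν := ν) (L := L) N) htop m
  have h := h1.div h2 hZ
  unfold uNCapRatio
  refine h.congr_deriv ?_
  have hdrop : ∀ y, uNCapZdrop N (topExponent (ν := ν) (L := L) N) y m =
      uNCapZ N (topExponent N - Finsupp.single y 1) m := by
    intro y
    have hy : y ∈ (topExponent (ν := ν) (L := L) N).support := by
      rw [Finsupp.mem_support_iff, topExponent_apply']; omega
    simp [uNCapZdrop, hy]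
  simp_rw [hdrop]
  rw [div_eq_iff (pow_ne_zero 2 hZ)]
  simp only [Finset.mul_sum, Finset.sum_mul, ← Finset.sum_sub_distrib]
  refine Finset.sum_congr rfl fun y _ => ?_
  field_simp

end Derivative

/-! ### The uniform susceptibility bound (clustering on average at `m > 0`) -/

section Susceptibility

variable [NeZero L] {N : ℕ}

/-- **Cauchy's estimate for the one-point function of the `U(N)` model**: for real `m > 0`, in
every volume (side `≥ 2`), `|d/dm ⟨σ_z⟩_Λ(m)| ≤ 2/m²` — the one-point function is holomorphic on
`|m' - m| < m/2` (no zeros of `Z_Λ` there, by the vendored fact) with the volume-independent bound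
`(2 Re m')⁻¹ ≤ 1/m`. [cite: SalmhoferSeiler1992Erratum, (5)][cite: SalmhoferSeiler1991, Cor. 3.9] -/
theorem norm_deriv_uNCapRatio_top_le (h : HallPuderSawinAmini_uNZeroFree) (hL2 : 2 ≤ L)
    (hN : 1 ≤ N) (z : TorusSite ν L) {m : ℝ} (hm : 0 < m) :
    ‖deriv (fun w : ℂ => uNCapRatio N z (topExponent (ν := ν) (L := L) N) w) (m : ℂ)‖ ≤
      2 / m ^ 2 := by
  have hR : 0 < m / 2 := by positivity
  have htop : ∀ x, topExponent (ν := ν) (L := L) N x ≤ N := fun x => (topExponent_apply' N x).le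
  have hc' : ∀ x,
      (topExponent (ν := ν) (L := L) N - Finsupp.single z 1 : TorusSite ν L →₀ ℕ) x ≤ N :=
    tsub_apply_le'' htop _
  -- points of the closed disc have `Re w ≥ m/2 > 0`
  have hre : ∀ w ∈ closedBall (m : ℂ) (m / 2), m / 2 ≤ w.re := by
    intro w hw
    have h1 : |w.re - m| ≤ ‖w - m‖ := by simpa using Complex.abs_re_le_norm (w - m)
    have h2 : ‖w - (m : ℂ)‖ ≤ m / 2 := mem_closedBall_iff_norm.1 hw
    have := abs_le.1 (h1.trans h2)
    linarith [this.1]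
  have hd : DiffContOnCl ℂ (fun w : ℂ => uNCapRatio N z (topExponent (ν := ν) (L := L) N) w)
      (ball (m : ℂ) (m / 2)) := by
    refine DifferentiableOn.diffContOnCl ?_
    rw [closure_ball _ hR.ne']
    intro w hw
    have hw' : 0 < w.re := lt_of_lt_of_le hR (hre w hw)
    unfold uNCapRatio
    exact ((hasDerivAt_uNCapZ _ hc' w).div (hasDerivAt_uNCapZ _ htop w)
      (uNCapZ_ne_zero_of_re_pos h hL2 hN htop hw')).differentiableAt.differentiableWithinAt
  refine (Complex.norm_deriv_le_of_forall_mem_sphere_norm_le hR hd (C := 1 / m)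
    fun w hw => ?_).trans (le_of_eq ?_)
  · have hw' : m / 2 ≤ w.re := hre w (sphere_subset_closedBall hw)
    have hw0 : 0 < w.re := lt_of_lt_of_le hR hw'
    refine (norm_uNCapRatio_top_le h hL2 hN z hw0).trans ?_
    rw [one_div]
    exact inv_anti₀ hm (by linarith)
  · field_simp

/-- **The uniform susceptibility bound for the `U(N)` model** (clustering on average at `m > 0`,
given the vendored zero-free fact): on any torus of side `≥ 2`, for `N ≥ 1`, a site `z` and real
`m > 0`, `|∑_y (⟨σ_zσ_y⟩_Λ(m) - ⟨σ_z⟩_Λ(m)⟨σ_y⟩_Λ(m))| ≤ 1/(N m²)`, independently of `Λ` — the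
bounded susceptibility that makes the `k = 0` mode of (4.13) harmless, which the paper takes from
clustering (Thm. 3.11; for `U(N)` the hypothesis of Remark 4.10 (3)).
[cite: SalmhoferSeiler1991, Thm. 4.3 (proof, (4.13)) and Remark 4.10 (3)][cite: SalmhoferSeiler1992Erratum, (5)] -/
theorem uN_susceptibility_bound (h : HallPuderSawinAmini_uNZeroFree) (hL2 : 2 ≤ L) (hN : 1 ≤ N)
    (z : TorusSite ν L) {m : ℝ} (hm : 0 < m) :
    ‖∑ y : TorusSite ν L,
      (uNCapZdrop N (topExponent N - Finsupp.single z 1) y (m : ℂ) /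
          uNCapZ N (topExponent (ν := ν) (L := L) N) (m : ℂ) -
        uNCapRatio N z (topExponent (ν := ν) (L := L) N) (m : ℂ) *
          uNCapRatio N y (topExponent (ν := ν) (L := L) N) (m : ℂ))‖ ≤ 1 / (N * m ^ 2) := by
  have hN' : (0 : ℝ) < N := by exact_mod_cast hN
  have htop : ∀ x, topExponent (ν := ν) (L := L) N x ≤ N := fun x => (topExponent_apply' N x).le
  have hZ : uNCapZ N (topExponent (ν := ν) (L := L) N) (m : ℂ) ≠ 0 :=
    uNCapZ_ne_zero_of_re_pos h hL2 hN htop (by rw [Complex.ofReal_re]; exact hm)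
  have hderiv := hasDerivAt_uNCapRatio_top (ν := ν) (L := L) hN z hZ
  have hb := norm_deriv_uNCapRatio_top_le (ν := ν) (L := L) h hL2 hN z hm
  rw [hderiv.deriv, norm_mul] at hb
  have h2N : ‖(2 * N : ℂ)‖ = 2 * N := by
    rw [norm_mul, Complex.norm_two, Complex.norm_natCast]
  rw [h2N] at hb
  rw [show 1 / (N * m ^ 2) = (2 / m ^ 2) / (2 * N) by field_simp]
  rw [le_div_iff₀ (by positivity)]
  linarith

end Susceptibility

/-! ### (4.15) for the U(N) model in finite volume -/

section FiniteVolume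

variable [NeZero L] {N : ℕ}

omit [NeZero L] in
/-- An even positive side is `≥ 2`. [folklore] -/
private theorem two_le_of_even'' [NeZero L] (hL : Even L) : 2 ≤ L := by
  obtain ⟨k, hk⟩ := hL
  have := NeZero.ne L
  omega

/-- `Z_Λ > 0` for the `U(N)` model at `m ≥ 0` on an even torus. [cite: SalmhoferSeiler1991, Thm. 3.18 (1)] -/
private theorem uN_partitionFunction_pos (hν : 1 ≤ ν) (hL : Even L) (hL2 : 2 ≤ L) {m : ℝ}
    (hm : 0 ≤ m) : 0 < partitionFunction (ν := ν) (L := L) N m (uNBondCoeff N) :=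
  partitionFunction_pos hL.two_dvd hL2 hν hm (fun k _ => uNBondCoeff_nonneg N k)
    (by rw [uNBondCoeff_zero]; exact one_pos) (uNBondCoeff_self_pos N)

/-- **The `k = 0` mode for `U(N)`** ("`T̂ = C(0)s²δ + ĝ`" in (4.13), in finite volume): at real
`m > 0` on any even torus, `ĝ_Λ(0) = ∑_y [σ_0σ_y]_Λ ≤ Z_Λ (|Λ| ⟨σ_0⟩_Λ² + 1/(Nm²))`, given the
vendored fact. [cite: SalmhoferSeiler1991, Thm. 4.3 (proof, (4.13)) and Remark 4.10 (3)] -/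
theorem uN_twoPtHat_zero_le (h : HallPuderSawinAmini_uNZeroFree) (hν : 1 ≤ ν) (hL : Even L)
    (hN : 1 ≤ N) {m : ℝ} (hm : 0 < m) :
    twoPtHat N m (uNBondCoeff N) (0 : AddChar (TorusSite ν L) ℂ) ≤
      partitionFunction (ν := ν) (L := L) N m (uNBondCoeff N) *
        (Fintype.card (TorusSite ν L) * expect N m (uNBondCoeff N) (X (0 : TorusSite ν L)) ^ 2 +
          1 / (N * m ^ 2)) := by
  have hL2 : 2 ≤ L := two_le_of_even'' hL
  have hZ : 0 < partitionFunction (ν := ν) (L := L) N m (uNBondCoeff N) :=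
    uN_partitionFunction_pos hν hL hL2 hm.le
  have hχ := uN_susceptibility_bound (ν := ν) (L := L) h hL2 hN (0 : TorusSite ν L) hm
  have hterm : ∀ y : TorusSite ν L,
      uNCapZdrop N (topExponent N - Finsupp.single (0 : TorusSite ν L) 1) y (m : ℂ) /
          uNCapZ N (topExponent (ν := ν) (L := L) N) (m : ℂ) -
        uNCapRatio N 0 (topExponent (ν := ν) (L := L) N) (m : ℂ) *
          uNCapRatio N y (topExponent (ν := ν) (L := L) N) (m : ℂ) =
      ((twoPt N m (uNBondCoeff N) 0 y / partitionFunction (ν := ν) (L := L) N m (uNBondCoeff N) -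
        expect N m (uNBondCoeff N) (X (0 : TorusSite ν L)) *
          expect N m (uNBondCoeff N) (X (0 : TorusSite ν L)) : ℝ) : ℂ) := by
    intro y
    rw [← uN_twoPt_ofReal hN m y, ← uN_partitionFunction_ofReal N m, ← uN_expect_X_ofReal hN m 0,
      ← uN_expect_X_ofReal hN m y, expect_X_eq_expect_X_zero N m _ y]
    push_cast
    ring
  simp_rw [hterm] at hχ
  rw [← Complex.ofReal_sum, Complex.norm_real, Real.norm_eq_abs] at hχ
  have h1 := (abs_le.1 hχ).2
  rw [Finset.sum_sub_distrib, Finset.sum_const, Finset.card_univ, nsmul_eq_mul,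
    ← Finset.sum_div] at h1
  rw [twoPtHat_zero_eq_sum]
  have h' : (∑ z : TorusSite ν L, twoPt N m (uNBondCoeff N) (0 : TorusSite ν L) z) /
      partitionFunction (ν := ν) (L := L) N m (uNBondCoeff N) ≤
        Fintype.card (TorusSite ν L) * expect N m (uNBondCoeff N) (X (0 : TorusSite ν L)) ^ 2 +
          1 / (N * m ^ 2) := by
    rw [sq]; linarith
  rwa [div_le_iff₀ hZ, mul_comm] at h'

/-- **(4.15) for the `U(N)` model in finite volume** (given the vendored fact).  For `N ≥ 1` on the
even torus `Λ = (ℤ/Lℤ)^ν` (`ν ≥ 1`) at real mass `m > 0`, with `s_Λ = ⟨σ_0⟩_Λ(m)` and the lattice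
sum `S_Λ(ν)` of (4.3):
`1 - 2m s_Λ ≤ 2νN s_Λ² + 2 S_Λ(ν) + (2ν/|Λ|)(1/m² + s_Λ/(2m))` — the sharp Schwinger–Dyson bound
`Z ≤ 2m[σ_0] + N∑_{|y|=1}[σ_0σ_y]` ((4.38) with `K(N) ↦ N`), the finite-volume infrared form
(4.40) of `∑_{|ξ|=1}T(ξ)`, the `k = 0` mode by `uN_twoPtHat_zero_le` and the `k = π̂` mode by the
Ward identity; the last term is the finite-size correction.
[cite: SalmhoferSeiler1991, Thm. 4.3 (proof, (4.10)–(4.15)), (4.38)–(4.40) and Remark 4.10 (3) (4.44)] -/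
theorem uN_sd_ineq_finiteVolume (h : HallPuderSawinAmini_uNZeroFree) (hν : 1 ≤ ν) (hL : Even L)
    (hN : 1 ≤ N) {m : ℝ} (hm : 0 < m) :
    1 - 2 * m * expect N m (uNBondCoeff N) (X (0 : TorusSite ν L)) ≤
      2 * ν * N * expect N m (uNBondCoeff N) (X (0 : TorusSite ν L)) ^ 2 + 2 * latticeS ν L +
        2 * ν / Fintype.card (TorusSite ν L) *
          (1 / m ^ 2 + expect N m (uNBondCoeff N) (X (0 : TorusSite ν L)) / (2 * m)) := by
  have hL2 : 2 ≤ L := two_le_of_even'' hL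
  have hZ : 0 < partitionFunction (ν := ν) (L := L) N m (uNBondCoeff N) :=
    uN_partitionFunction_pos hν hL hL2 hm.le
  have hNpos : (0 : ℝ) < N := by exact_mod_cast hN
  have hcard : (0 : ℝ) < Fintype.card (TorusSite ν L) := Nat.cast_pos.2 Fintype.card_pos
  -- (4.38) sharp, (4.40), the two modes
  have hsd := uN_partitionFunction_le_sharp (ν := ν) (L := L) hN hL2 hm.le (0 : TorusSite ν L)
  rw [sum_bracket_nbr_zero] at hsd
  have hir := sum_twoPt_nbr_le hν hL hN m (fun k hk => uN_fluctCoeff_nonneg hN k hk)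
  have h0 := uN_twoPtHat_zero_le h hν hL hN hm
  have hπ := twoPtHat_stagChar_eq hL.two_dvd hL2 hν (hasLog_logCoeff hN (uNBondCoeff_zero N)) m
  set Z := partitionFunction (ν := ν) (L := L) N m (uNBondCoeff N) with hZdef
  set s := expect N m (uNBondCoeff N) (X (0 : TorusSite ν L)) with hsdef
  set g0 := twoPtHat N m (uNBondCoeff N) (0 : AddChar (TorusSite ν L) ℂ) with hg0
  set gπ := twoPtHat N m (uNBondCoeff N) (stagChar (ν := ν) (L := L) hL.two_dvd) with hgπ
  set n : ℝ := (Fintype.card (TorusSite ν L) : ℝ) with hn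
  have hbr : bracket N m (uNBondCoeff N) (X (0 : TorusSite ν L)) = s * Z := by
    rw [hsdef, expect_eq_div, div_mul_cancel₀ _ hZ.ne']
  rw [hbr] at hsd hπ
  -- `-ĝ(π̂) = Z s/(2Nm)`
  have hπ' : -gπ = Z * (s / (2 * N * m)) := by
    have h2Nm : (2 * N * m : ℝ) ≠ 0 := by positivity
    field_simp
    linarith [hπ]
  have h1 : Z * (1 - 2 * m * s) ≤
      N * (2 * ν / n * (Z * (n * s ^ 2 + 1 / (N * m ^ 2)) + Z * (s / (2 * N * m))) +
        2 / N * Z * latticeS ν L) := by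
    have hcoef : 0 ≤ 2 * (ν : ℝ) / n := by positivity
    have hmodes : g0 - gπ ≤ Z * (n * s ^ 2 + 1 / (N * m ^ 2)) + Z * (s / (2 * N * m)) := by
      rw [sub_eq_add_neg, hπ']
      linarith [h0]
    calc Z * (1 - 2 * m * s)
        ≤ N * ∑ μ : Fin ν, (twoPt N m (uNBondCoeff N) (0 : TorusSite ν L) (Pi.single μ 1) +
            twoPt N m (uNBondCoeff N) (0 : TorusSite ν L) (-Pi.single μ 1)) := by
          linarith [hsd]
      _ ≤ N * (2 * ν / n * (g0 - gπ) + 2 / N * Z * latticeS ν L) :=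
          mul_le_mul_of_nonneg_left hir hNpos.le
      _ ≤ _ := by
          have := mul_le_mul_of_nonneg_left hmodes hcoef
          nlinarith
  have key : Z * (1 - 2 * m * s) ≤
      Z * (2 * ν * N * s ^ 2 + 2 * latticeS ν L +
        2 * ν / n * (1 / m ^ 2 + s / (2 * m))) := by
    refine h1.trans_eq ?_
    field_simp
    ring
  exact le_of_mul_le_mul_left key hZ

/-- **(4.15) for `U(N)` in finite volume, finite-size term explicit**: under the same hypotheses,
`1 - 2m s_Λ ≤ 2νN s_Λ² + 2 S_Λ(ν) + 5ν/(2m²|Λ|)` (using `0 ≤ s_Λ`, `2m s_Λ ≤ 1` from (4.6)).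
[cite: SalmhoferSeiler1991, Thm. 4.3 (proof, (4.10)–(4.15)) and Remark 4.10 (3) (4.44)] -/
theorem uN_sd_ineq_finiteVolume' (h : HallPuderSawinAmini_uNZeroFree) (hν : 1 ≤ ν) (hL : Even L)
    (hN : 1 ≤ N) {m : ℝ} (hm : 0 < m) :
    1 - 2 * m * expect N m (uNBondCoeff N) (X (0 : TorusSite ν L)) ≤
      2 * ν * N * expect N m (uNBondCoeff N) (X (0 : TorusSite ν L)) ^ 2 + 2 * latticeS ν L +
        5 * ν / (2 * m ^ 2 * Fintype.card (TorusSite ν L)) := by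
  have hL2 : 2 ≤ L := two_le_of_even'' hL
  have h1 := uN_sd_ineq_finiteVolume h hν hL hN hm
  have hmf := uN_meanField_ineq_allN hν hL hL2 hN hm.le (0 : TorusSite ν L)
  have hs0 := uN_expect_X_nonneg_allN hν hL hL2 hN hm.le (0 : TorusSite ν L)
  set s := expect N m (uNBondCoeff N) (X (0 : TorusSite ν L)) with hsdef
  have hν0 : (0 : ℝ) ≤ ν := by positivity
  have hcard : (0 : ℝ) < Fintype.card (TorusSite ν L) := Nat.cast_pos.2 Fintype.card_pos
  -- `2ms ≤ 1`, so `s/(2m) ≤ 1/(4m²)`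
  have h2ms : 2 * m * s ≤ 1 := by nlinarith [sq_nonneg s]
  have hs1 : s / (2 * m) ≤ 1 / (4 * m ^ 2) := by
    rw [div_le_div_iff₀ (by positivity) (by positivity)]
    have h' := mul_le_mul_of_nonneg_right h2ms (by positivity : (0 : ℝ) ≤ 2 * m)
    linarith
  have herr : 2 * ν / Fintype.card (TorusSite ν L) * (1 / m ^ 2 + s / (2 * m)) ≤
      5 * ν / (2 * m ^ 2 * Fintype.card (TorusSite ν L)) := by
    calc 2 * ν / Fintype.card (TorusSite ν L) * (1 / m ^ 2 + s / (2 * m))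
        ≤ 2 * ν / Fintype.card (TorusSite ν L) * (1 / m ^ 2 + 1 / (4 * m ^ 2)) :=
          mul_le_mul_of_nonneg_left (by linarith) (by positivity)
      _ = 5 * ν / (2 * m ^ 2 * Fintype.card (TorusSite ν L)) := by
          field_simp
          ring
  linarith

end FiniteVolume

/-! ### Remark 4.10 (3) / (4.44): the lower bound on the U(N) condensate, all large volumes -/

section LowerBound

variable {N : ℕ}

/-- **Remark 4.10 (3) ∕ (4.44) for the `U(N)` model at `β = 0`, every `N ≥ 1`, with the clustering
hypothesis discharged by the Hall–Puder–Sawin ∕ Amini zero-free fact `h`.**  For `ν ≥ 3`, `N ≥ 1`,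
a real mass `m > 0` and every `ε > 0` there is `L₀` such that on every even torus `(ℤ/Lℤ)^ν` with
`L ≥ L₀`:  `⟨σ_0⟩_Λ(m) ≥ s₂(m) - ε`, where `s₂(m) = (√(m² + 2νN(1 - 2S(ν))) - m)/(2νN)` is the
positive root of `2νN s² + 2ms = 1 - 2S(ν)` — the printed (4.44) with `K(N)` replaced by the sharp
constant `N` (so every `N`, not `N ≤ 4`) and `S(ν)` the printed fluctuation sum (4.3).  Uniform in
the volume; no thermodynamic limit is asserted. [cite: SalmhoferSeiler1991, Remark 4.10 (3) (4.44) and Thm. 4.3 (4.8)–(4.9)][cite: Amini2019, Thm. 3.7][cite: HallPuderSawin2018, §2.2 and §5.2] -/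
theorem uN_condensate_lower_bound (h : HallPuderSawinAmini_uNZeroFree) (hν : 3 ≤ ν) (hN : 1 ≤ N)
    {m : ℝ} (hm : 0 < m) {ε : ℝ} (hε : 0 < ε) :
    ∃ L₀ : ℕ, ∀ (L : ℕ) [NeZero L], Even L → L₀ ≤ L →
      (Real.sqrt (m ^ 2 + 2 * ν * N * (1 - 2 * fluctS ν)) - m) / (2 * ν * N) - ε ≤
        expect N m (uNBondCoeff N) (X (0 : TorusSite ν L)) := by
  have hν1 : 1 ≤ ν := by omega
  have hνpos : (0 : ℝ) < ν := by exact_mod_cast (show 0 < ν by omega)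
  have hNpos : (0 : ℝ) < N := by exact_mod_cast hN
  set A : ℝ := 2 * ν * N with hA
  have hApos : 0 < A := by positivity
  set R : ℝ := m ^ 2 + A * (1 - 2 * fluctS ν) with hR
  -- continuity of `√` at `R`
  obtain ⟨δ, hδ, hcont⟩ := Metric.continuousAt_iff.1 (Real.continuous_sqrt.continuousAt (x := R))
    (A * ε) (by positivity)
  -- `S_Λ(ν) → S(ν)`
  obtain ⟨L₁, hL₁⟩ := latticeS_tendsto_fluctS (ν := ν) hν (ε := δ / (8 * A)) (by positivity)
  -- the finite-size term
  obtain ⟨L₂, hL₂⟩ := exists_nat_gt (5 * ν * A / (m ^ 2 * δ))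
  refine ⟨max (max L₁ L₂) 2, fun L _ hL hLe => ?_⟩
  have hL2 : 2 ≤ L := le_trans (le_max_right _ _) hLe
  have hLL₁ : L₁ ≤ L := le_trans (le_trans (le_max_left _ _) (le_max_left _ _)) hLe
  have hLL₂ : L₂ ≤ L := le_trans (le_trans (le_max_right _ _) (le_max_left _ _)) hLe
  have hfin := uN_sd_ineq_finiteVolume' (ν := ν) (L := L) h hν1 hL hN hm
  have hs0 := uN_expect_X_nonneg_allN hν1 hL hL2 hN hm.le (0 : TorusSite ν L)
  set s := expect N m (uNBondCoeff N) (X (0 : TorusSite ν L)) with hsdef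
  set n : ℝ := (Fintype.card (TorusSite ν L) : ℝ) with hn
  set dL : ℝ := 5 * ν / (2 * m ^ 2 * n) with hdL
  have hcard : (0 : ℝ) < n := by rw [hn]; exact Nat.cast_pos.2 Fintype.card_pos
  -- `(A s + m)² ≥ R_L := m² + A (1 - 2 S_Λ - dL)`
  set RL : ℝ := m ^ 2 + A * (1 - 2 * latticeS ν L - dL) with hRL
  have hfin' : 1 - 2 * m * s ≤ A * s ^ 2 + 2 * latticeS ν L + dL := by
    rw [hA, hdL]; linarith [hfin]
  have hsq : RL ≤ (A * s + m) ^ 2 := by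
    have e : (A * s + m) ^ 2 - RL = A * ((A * s ^ 2 + 2 * latticeS ν L + dL) - (1 - 2 * m * s)) := by
      rw [hRL]; ring
    have : 0 ≤ A * ((A * s ^ 2 + 2 * latticeS ν L + dL) - (1 - 2 * m * s)) :=
      mul_nonneg hApos.le (by linarith)
    linarith
  have h3 : Real.sqrt RL ≤ A * s + m := by
    rw [← Real.sqrt_sq (by positivity : (0 : ℝ) ≤ A * s + m)]
    exact Real.sqrt_le_sqrt hsq
  -- `|R_L - R| < δ`
  have hS : |latticeS ν L - fluctS ν| ≤ δ / (8 * A) := hL₀' hL₁ L hL hLL₁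
  have hnL : (L : ℝ) ≤ n := by
    rw [hn, Fintype.card_fun, ZMod.card, Fintype.card_fin]
    exact_mod_cast Nat.le_self_pow (by omega) L
  have hLpos : (0 : ℝ) < L := by exact_mod_cast (show 0 < L by omega)
  have hdL' : A * dL < δ / 2 := by
    have hL₂' : 5 * ν * A / (m ^ 2 * δ) < L := lt_of_lt_of_le hL₂ (by exact_mod_cast hLL₂)
    have h1 : A * dL ≤ 5 * ν * A / (2 * m ^ 2 * L) := by
      rw [hdL]
      have : 5 * (ν : ℝ) / (2 * m ^ 2 * n) ≤ 5 * ν / (2 * m ^ 2 * L) :=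
        div_le_div_of_nonneg_left (by positivity) (by positivity) (by nlinarith)
      calc A * dL = A * (5 * ν / (2 * m ^ 2 * n)) := by rw [hdL]
        _ ≤ A * (5 * ν / (2 * m ^ 2 * L)) := mul_le_mul_of_nonneg_left this hApos.le
        _ = 5 * ν * A / (2 * m ^ 2 * L) := by ring
    have h2 : 5 * ν * A / (2 * m ^ 2 * L) < δ / 2 := by
      rw [div_lt_div_iff₀ (by positivity) (by positivity)]
      rw [div_lt_iff₀ (by positivity)] at hL₂'
      nlinarith
    linarith
  have hdL0 : 0 ≤ dL := by positivity
  have hdist : dist RL R < δ := by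
    rw [Real.dist_eq, hRL, hR]
    have e : m ^ 2 + A * (1 - 2 * latticeS ν L - dL) - (m ^ 2 + A * (1 - 2 * fluctS ν)) =
        -(2 * A * (latticeS ν L - fluctS ν) + A * dL) := by ring
    rw [e, abs_neg]
    have hb : |2 * A * (latticeS ν L - fluctS ν)| ≤ δ / 4 := by
      rw [abs_mul, abs_of_pos (by positivity : (0 : ℝ) < 2 * A)]
      calc 2 * A * |latticeS ν L - fluctS ν| ≤ 2 * A * (δ / (8 * A)) :=
            mul_le_mul_of_nonneg_left hS (by positivity)
        _ = δ / 4 := by field_simp; ring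
    calc |2 * A * (latticeS ν L - fluctS ν) + A * dL|
        ≤ |2 * A * (latticeS ν L - fluctS ν)| + |A * dL| := abs_add_le _ _
      _ < δ / 4 + δ / 2 := by
          rw [abs_of_nonneg (by positivity : (0 : ℝ) ≤ A * dL)]
          linarith
      _ ≤ δ := by linarith
  have hsqrt : dist (Real.sqrt RL) (Real.sqrt R) < A * ε := hcont hdist
  rw [Real.dist_eq] at hsqrt
  have h4 : Real.sqrt R - A * ε < Real.sqrt RL := by
    have := (abs_lt.1 hsqrt).1; linarith
  -- conclude
  have h5 : Real.sqrt R - m - A * ε ≤ A * s := by linarith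
  rw [sub_le_iff_le_add, div_le_iff₀ hApos]
  nlinarith
  where
  /-- unpacking helper -/
  hL₀' {L₁ : ℕ} {δ' : ℝ}
      (hL₁ : ∀ (L : ℕ) [NeZero L], Even L → L₁ ≤ L → |latticeS ν L - fluctS ν| ≤ δ')
      (L : ℕ) [NeZero L] (hL : Even L) (hle : L₁ ≤ L) : |latticeS ν L - fluctS ν| ≤ δ' :=
    hL₁ L hL hle

/-- **Chiral symmetry breaking in the condensate form for the `U(N)` model at `β = 0`, every `N`**
(given the vendored fact): if `2S(ν) < 1` (certified for `ν ≥ 4` in the tree), then for `N ≥ 1`,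
every mass `0 < m ≤ 1` and every `ε > 0`, on all large even tori
`⟨σ_0⟩_Λ(m) ≥ (1 - 2S(ν))/(√(1 + 2νN(1 - 2S(ν))) + 1) - ε`, a positive constant INDEPENDENT of
`m` and `Λ` — so `⟨ψ̄ψ⟩ = 2N⟨σ_0⟩` stays bounded away from `0` as `m → 0⁺` after the volume limit
(Remark 4.10 (3) with Cor. 4.4 (1)). [cite: SalmhoferSeiler1991, Remark 4.10 (3) (4.44) and Cor. 4.4 (1)][cite: Amini2019, Thm. 3.7][cite: HallPuderSawin2018, §2.2 and §5.2] -/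
theorem uN_chiralCondensate_pos (h : HallPuderSawinAmini_uNZeroFree) (hν : 3 ≤ ν) (hN : 1 ≤ N)
    (hS : 2 * fluctS ν < 1) {m : ℝ} (hm : 0 < m) (hm1 : m ≤ 1) {ε : ℝ} (hε : 0 < ε) :
    ∃ L₀ : ℕ, ∀ (L : ℕ) [NeZero L], Even L → L₀ ≤ L →
      (1 - 2 * fluctS ν) / (Real.sqrt (1 + 2 * ν * N * (1 - 2 * fluctS ν)) + 1) - ε ≤
        expect N m (uNBondCoeff N) (X (0 : TorusSite ν L)) := by
  obtain ⟨L₀, hL₀⟩ := uN_condensate_lower_bound (ν := ν) h hν hN hm hε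
  refine ⟨L₀, fun L _ hL hLe => le_trans ?_ (hL₀ L hL hLe)⟩
  have hνpos : (0 : ℝ) < ν := by exact_mod_cast (show 0 < ν by omega)
  have hNpos : (0 : ℝ) < N := by exact_mod_cast hN
  set A : ℝ := 2 * ν * N with hA
  set κ : ℝ := 1 - 2 * fluctS ν with hκ
  have hApos : 0 < A := by positivity
  have hκpos : 0 < κ := by rw [hκ]; linarith
  apply sub_le_sub_right
  -- `κ/(√(1 + Aκ) + 1) ≤ (√(m² + Aκ) - m)/A` for `0 < m ≤ 1`
  have hq1 : 0 < Real.sqrt (1 + A * κ) + 1 := by positivity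
  have hqm : 0 < Real.sqrt (m ^ 2 + A * κ) + m := by positivity
  -- `(√(m²+Aκ) - m)(√(m²+Aκ) + m) = Aκ`
  have hprod : (Real.sqrt (m ^ 2 + A * κ) - m) * (Real.sqrt (m ^ 2 + A * κ) + m) = A * κ := by
    have h0 : 0 ≤ m ^ 2 + A * κ := by positivity
    nlinarith [Real.mul_self_sqrt h0]
  have hmono : Real.sqrt (m ^ 2 + A * κ) + m ≤ Real.sqrt (1 + A * κ) + 1 := by
    have : Real.sqrt (m ^ 2 + A * κ) ≤ Real.sqrt (1 + A * κ) :=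
      Real.sqrt_le_sqrt (by nlinarith)
    linarith
  have heq : (Real.sqrt (m ^ 2 + A * κ) - m) / A = κ / (Real.sqrt (m ^ 2 + A * κ) + m) := by
    rw [div_eq_div_iff hApos.ne' hqm.ne', hprod]
    ring
  rw [heq]
  exact div_le_div_of_nonneg_left hκpos.le hqm hmono

/-- The constant of `uN_chiralCondensate_pos` is positive when `2S(ν) < 1`. [cite: SalmhoferSeiler1991, Thm. 4.3 (4.9) and Remark 4.10 (3)] -/
theorem uN_chiralCondensate_const_pos (hS : 2 * fluctS ν < 1) (N : ℕ) :
    0 < (1 - 2 * fluctS ν) / (Real.sqrt (1 + 2 * ν * N * (1 - 2 * fluctS ν)) + 1) := by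
  have hκ : 0 < 1 - 2 * fluctS ν := by linarith
  positivity

end LowerBound

end ComplexSpin

end Literature.MathematicalPhysics.StatisticalMechanics

end
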